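import Summits.CriticalPhenomena.PercolationContinuityZ3.Theorems.PercNearOneGluingNoHeavyLowerTailSahiGridPatternStarBlockEquiv
import Summits.CriticalPhenomena.PercolationContinuityZ3.Theorems.PercNearOneGluingNoHeavyLowerTailSahiGridPatternStarLiteralGeneral

/-!
# `NoHeavyLowerTail` (crux stmt-CriticalPhenomena-4575), Sahi programme P1: **CLAUSE ∨ MONOMIAL ∨ MONOMIAL** — every star with at most two
# multi-axis blocks is a good first slot (arbitrary positions), and Kahn's `E₃ ≥ 0` for such read-once DNFs on every grid

Support file (Sahi cell, seat `prim-sahi-p1`, generation 22; `--supports stmt-CriticalPhenomena-4575`).  Pure proofs, no definitions,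
no `sorry`, standard axioms.  Assembles `sStarD_cylSet_clauseTwoOrthant_nonneg` (`…StarPrefix`, block form), `exists_block_equiv3`
(`…StarBlockEquiv`), `sStarD_nonneg_transfer` (`…TwoOrthantGeneral`) and the degenerate cases of `…StarLiteralGeneral`.

RESULTS.  `sStarD_clauseTwoOrthant_nonneg` (every `d`): for pairwise disjoint `T, S₁, S₂ ⊆ Fin d`, thresholds `u` (nonzero on `T`) and flags
`w₁, w₂`, the up-set `{p : (∃ i ∈ T, u i ≤ p i) ∨ (w₁ ∧ ∀ a ∈ S₁, u a ≤ p a) ∨ (w₂ ∧ ∀ a ∈ S₂, u a ≤ p a)}` is a good first slot of the pattern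
functional.  VALUE LEVEL (**`sahiE_three_clauseTwoOrthant_nonneg`**): for every product probability weight on every grid `[K+1]^d`, pairwise
disjoint `T, S₁, S₂`, thresholds `c`, flags, and all increasing `B, C`: `0 ≤ E₃(1_A, 1_B, 1_C)` for
`A = {x : (∃ i ∈ T, c i ≤ x i) ∨ (w₁ ∧ ∀ a ∈ S₁, c a ≤ x a) ∨ (w₂ ∧ ∀ a ∈ S₂, c a ≤ x a)}` — Kahn's Conjecture 5 / Sahi's `C₃` when one event is a
READ-ONCE MONOTONE DNF WITH AT MOST TWO TERMS OF WIDTH ≥ 2 (the generation-22 paper theorem "every star with ≤ 2 multi-axis blocks", in Lean).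
Nothing here asserts `PatternPos d` for `d ≥ 4`. [this work]
-/

namespace Summit.CriticalPhenomena.PercolationContinuityZ3.Theorems.SahiGridPattern

open Finset SahiGrid3 Literature.Probability.LatticeModels Literature.Combinatorics.Sahi2008
open scoped BigOperators

/-! ### Arbitrary axis positions -/

/-- **THE CLAUSE ∨ MONOMIAL ∨ MONOMIAL SLOT IN ARBITRARY POSITION** (every `d`). [this work] -/
theorem sStarD_clauseTwoOrthant_nonneg {d : ℕ} (T S₁ S₂ : Finset (Fin d)) (hT1 : Disjoint T S₁) (hT2 : Disjoint T S₂) (h12 : Disjoint S₁ S₂)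
    (u : Fin d → Fin 3) (hu : ∀ i ∈ T, u i ≠ 0) (w₁ w₂ : Bool)
    {B C : Finset (Pd d)} (hB : IsUpperSet (B : Set (Pd d))) (hC : IsUpperSet (C : Set (Pd d))) :
    0 ≤ sStarD (univ.filter fun p : Pd d => (∃ i ∈ T, u i ≤ p i) ∨ (w₁ = true ∧ ∀ a ∈ S₁, u a ≤ p a)
      ∨ (w₂ = true ∧ ∀ a ∈ S₂, u a ≤ p a)) B C := by
  classical
  -- degenerate flags: one orthant term absent
  by_cases hw1 : w₁ = true
  swap
  · have e : (univ.filter fun p : Pd d => (∃ i ∈ T, u i ≤ p i) ∨ (w₁ = true ∧ ∀ a ∈ S₁, u a ≤ p a) ∨ (w₂ = true ∧ ∀ a ∈ S₂, u a ≤ p a))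
        = univ.filter fun p : Pd d => (∃ i ∈ T, u i ≤ p i) ∨ (w₂ = true ∧ ∀ a ∈ S₂, u a ≤ p a) := by
      refine Finset.filter_congr fun p _ => ?_
      constructor
      · rintro (h | ⟨h, _⟩ | h)
        · exact Or.inl h
        · exact absurd h hw1
        · exact Or.inr h
      · rintro (h | h)
        · exact Or.inl h
        · exact Or.inr (Or.inr h)
    rw [e]; exact sStarD_clauseOrthant_nonneg T S₂ hT2 u hu w₂ hB hC
  by_cases hw2 : w₂ = true
  swap
  · have e : (univ.filter fun p : Pd d => (∃ i ∈ T, u i ≤ p i) ∨ (w₁ = true ∧ ∀ a ∈ S₁, u a ≤ p a) ∨ (w₂ = true ∧ ∀ a ∈ S₂, u a ≤ p a))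
        = univ.filter fun p : Pd d => (∃ i ∈ T, u i ≤ p i) ∨ (w₁ = true ∧ ∀ a ∈ S₁, u a ≤ p a) := by
      refine Finset.filter_congr fun p _ => ?_
      constructor
      · rintro (h | h | ⟨h, _⟩)
        · exact Or.inl h
        · exact Or.inr h
        · exact absurd h hw2
      · rintro (h | h)
        · exact Or.inl h
        · exact Or.inr (Or.inl h)
    rw [e]; exact sStarD_clauseOrthant_nonneg T S₁ hT1 u hu w₁ hB hC
  -- drop the zero-threshold axes of the first orthant
  set S₁' : Finset (Fin d) := S₁.filter fun a => u a ≠ 0 with hS₁'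
  have k1 : ∀ p : Pd d, (∀ a ∈ S₁, u a ≤ p a) ↔ (∀ a ∈ S₁', u a ≤ p a) := by
    intro p
    constructor
    · intro h a ha; rw [hS₁', Finset.mem_filter] at ha; exact h a ha.1
    · intro h a ha
      by_cases hz : u a = 0
      · rw [hz]; exact Fin.zero_le _
      · exact h a (by rw [hS₁', Finset.mem_filter]; exact ⟨ha, hz⟩)
  by_cases hempty : S₁' = ∅
  · -- the first orthant term is always true: the slot is the whole cube
    have e : (univ.filter fun p : Pd d => (∃ i ∈ T, u i ≤ p i) ∨ (w₁ = true ∧ ∀ a ∈ S₁, u a ≤ p a) ∨ (w₂ = true ∧ ∀ a ∈ S₂, u a ≤ p a)) = univ := by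
      refine Finset.filter_true_of_mem fun p _ => Or.inr (Or.inl ⟨hw1, (k1 p).2 ?_⟩)
      rw [hempty]; intro a ha; simp at ha
    rw [e]; exact sStarD_nonneg_of_eq_univ₁ hB hC
  have hT1' : Disjoint T S₁' := Finset.disjoint_of_subset_right (Finset.filter_subset _ _) hT1
  have h12' : Disjoint S₁' S₂ := Finset.disjoint_of_subset_left (Finset.filter_subset _ _) h12
  obtain ⟨e, heT, he1, he2, hsT, hs1, hs2⟩ := exists_block_equiv3 T S₁' S₂ hT1' hT2 h12'
  have hn : 0 < S₁'.card := Finset.card_pos.2 (Finset.nonempty_iff_ne_empty.2 hempty)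
  set uT : Fin T.card → Fin 3 := fun i => u (e (Fin.natAdd _ (Fin.castAdd _ i))) with huT
  set a : Pd S₁'.card := fun j => u (e (Fin.natAdd _ (Fin.natAdd _ (Fin.castAdd _ j)))) with ha
  set b : Pd S₂.card := fun l => u (e (Fin.natAdd _ (Fin.natAdd _ (Fin.natAdd _ l)))) with hb
  have huT' : ∀ i, uT i ≠ 0 := fun i => hu _ (heT i)
  have ha0 : ∀ j, a j ≠ 0 := fun j => (Finset.mem_filter.1 (he1 j)).2
  have ha' : (∃ j, a j = 2) ∨ (∀ j, a j = 1) := by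
    by_cases h : ∃ j, a j = 2
    · exact Or.inl h
    · refine Or.inr fun j => ?_
      have h2 : a j ≠ 2 := fun hj => h ⟨j, hj⟩
      have : ∀ v : Fin 3, v ≠ 0 → v ≠ 2 → v = 1 := by decide
      exact this _ (ha0 j) h2
  refine sStarD_nonneg_transfer e (fun B' C' hB' hC' => sStarD_cylSet_clauseTwoOrthant_nonneg (m := (T ∪ S₁' ∪ S₂)ᶜ.card) uT huT' a ha' hn b
    hB' hC') (fun p => ?_) B C hB hC
  rw [Finset.mem_filter, mem_cylSet_iff, Finset.mem_filter, Finset.mem_union, Finset.mem_filter, Finset.mem_filter]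
  simp only [Finset.mem_univ, true_and, hw1, hw2]
  have lit : (∃ i ∈ T, u i ≤ p i) ↔ (∃ i : Fin T.card, uT i ≤ cellOf (p ∘ e) (Fin.castAdd _ i)) := by
    constructor
    · rintro ⟨s, hs, hle⟩
      obtain ⟨i, hi⟩ := hsT s hs
      refine ⟨i, ?_⟩
      rw [huT]; simp only [cellOf, Function.comp_apply]; rw [hi]; exact hle
    · rintro ⟨i, hle⟩
      refine ⟨_, heT i, ?_⟩
      rw [huT] at hle; simpa [cellOf] using hle
  have or1 : (∀ s ∈ S₁, u s ≤ p s) ↔ (∀ j : Fin S₁'.card, a j ≤ (fun c => cellOf (p ∘ e) (Fin.natAdd T.card c)) (Fin.castAdd _ j)) := by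
    rw [k1]
    constructor
    · intro h j
      rw [ha]; simp only [cellOf, Function.comp_apply]; exact h _ (he1 j)
    · intro h s hs
      obtain ⟨j, hj⟩ := hs1 s hs
      have := h j
      rw [ha] at this; simp only [cellOf, Function.comp_apply] at this; rw [hj] at this; exact this
  have or2 : (∀ s ∈ S₂, u s ≤ p s) ↔ (∀ l : Fin S₂.card, b l ≤ (fun c => cellOf (p ∘ e) (Fin.natAdd T.card c)) (Fin.natAdd _ l)) := by
    constructor
    · intro h l
      rw [hb]; simp only [cellOf, Function.comp_apply]; exact h _ (he2 l)
    · intro h s hs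
      obtain ⟨l, hl⟩ := hs2 s hs
      have := h l
      rw [hb] at this; simp only [cellOf, Function.comp_apply] at this; rw [hl] at this; exact this
  rw [lit, or1, or2]

/-! ### Value level -/

variable {d K : ℕ}

/-- **The symmetrised pattern value of (clause ∨ monomial ∨ monomial, up-set, up-set) is nonnegative** at every three-point sample. [this work] -/
theorem Ssym_nonneg_clauseTwoOrthant (T S₁ S₂ : Finset (Fin d)) (hT1 : Disjoint T S₁) (hT2 : Disjoint T S₂) (h12 : Disjoint S₁ S₂)
    (c : Fin d → Fin (K + 1)) (w₁ w₂ : Bool)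
    {B C : Finset (Xd d K)} (hB : IsUpperSet (B : Set (Xd d K))) (hC : IsUpperSet (C : Set (Xd d K))) (ω : Fin 3 → Xd d K) :
    0 ≤ Ssym (univ.filter fun x : Xd d K => (∃ i ∈ T, c i ≤ x i) ∨ (w₁ = true ∧ ∀ a ∈ S₁, c a ≤ x a)
      ∨ (w₂ = true ∧ ∀ a ∈ S₂, c a ≤ x a)) B C ω := by
  classical
  set A : Finset (Xd d K) := univ.filter fun x : Xd d K => (∃ i ∈ T, c i ≤ x i) ∨ (w₁ = true ∧ ∀ a ∈ S₁, c a ≤ x a)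
    ∨ (w₂ = true ∧ ∀ a ∈ S₂, c a ≤ x a) with hAdef
  let σ : Fin d → Equiv.Perm (Fin 3) := fun a => Tuple.sort fun cc => ω cc a
  have hsort : ∀ a, Monotone fun cc => Tmap σ ω cc a := fun a => by
    show Monotone ((fun cc => ω cc a) ∘ σ a)
    exact Tuple.monotone_sort _
  rw [← S_Tmap A B C σ ω, S_eq_sStarD]
  set ω' : Fin 3 → Xd d K := Tmap σ ω with hω'
  have hB' := isUpperSet_pb hsort hB
  have hC' := isUpperSet_pb hsort hC
  have mem_pb : ∀ p : Pd d, p ∈ pb ω' A ↔ ((∃ i ∈ T, c i ≤ ω' (p i) i) ∨ (w₁ = true ∧ ∀ a ∈ S₁, c a ≤ ω' (p a) a)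
      ∨ (w₂ = true ∧ ∀ a ∈ S₂, c a ≤ ω' (p a) a)) := by
    intro p; unfold pb; rw [Finset.mem_filter, hAdef, Finset.mem_filter]; simp
  have ax : ∀ a : Fin d, (∀ cc : Fin 3, ¬ c a ≤ ω' cc a) ∨ ∃ t : Fin 3, ∀ cc : Fin 3, (c a ≤ ω' cc a ↔ t ≤ cc) :=
    fun a => threshold_three_le (fun cc => ω' cc a) (hsort a) (c a)
  have ht : ∀ a, ∃ o : Option (Fin 3), (o = none → ∀ cc : Fin 3, ¬ c a ≤ ω' cc a) ∧ (∀ t, o = some t → ∀ cc : Fin 3, (c a ≤ ω' cc a ↔ t ≤ cc)) := by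
    intro a
    rcases ax a with h | ⟨t, h⟩
    · refine ⟨none, fun _ => h, ?_⟩
      intro t ht; exact absurd ht (by simp)
    · refine ⟨some t, ?_, ?_⟩
      · intro h'; exact absurd h' (by simp)
      · intro t' ht'
        rw [Option.some.injEq] at ht'
        subst ht'
        exact h
  choose o ho1 ho2 using ht
  by_cases hzero : ∃ i ∈ T, o i = some 0
  · obtain ⟨i, hi, hoi⟩ := hzero
    have e : pb ω' A = univ := by
      refine Finset.eq_univ_of_forall fun p => (mem_pb p).2 (Or.inl ⟨i, hi, ?_⟩)
      exact (ho2 i 0 hoi (p i)).2 (Fin.zero_le _)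
    rw [e]; exact sStarD_nonneg_of_eq_univ₁ hB' hC'
  set T' : Finset (Fin d) := T.filter fun i => o i ≠ none with hT'
  set u : Fin d → Fin 3 := fun a => (o a).getD 0 with hudef
  set w₁' : Bool := (w₁ && decide (∀ a ∈ S₁, o a ≠ none)) with hw₁'
  set w₂' : Bool := (w₂ && decide (∀ a ∈ S₂, o a ≠ none)) with hw₂'
  have hT1' : Disjoint T' S₁ := Finset.disjoint_of_subset_left (Finset.filter_subset _ _) hT1
  have hT2' : Disjoint T' S₂ := Finset.disjoint_of_subset_left (Finset.filter_subset _ _) hT2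
  have hu : ∀ i ∈ T', u i ≠ 0 := by
    intro i hi
    rw [hT', Finset.mem_filter] at hi
    obtain ⟨t, hti⟩ := Option.ne_none_iff_exists'.1 hi.2
    have hut : u i = t := by rw [hudef]; simp [hti]
    rw [hut]; intro ht0
    exact hzero ⟨i, hi.1, by rw [hti, ht0]⟩
  have orth : ∀ (S : Finset (Fin d)) (w : Bool) (p : Pd d), (w = true ∧ ∀ a ∈ S, c a ≤ ω' (p a) a)
      ↔ ((w && decide (∀ a ∈ S, o a ≠ none)) = true ∧ ∀ a ∈ S, u a ≤ p a) := by
    intro S w p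
    simp only [Bool.and_eq_true, decide_eq_true_eq]
    constructor
    · rintro ⟨hw, h⟩
      have hne : ∀ a ∈ S, o a ≠ none := fun a ha hn => ho1 a hn (p a) (h a ha)
      refine ⟨⟨hw, hne⟩, fun a ha => ?_⟩
      obtain ⟨t, hta⟩ := Option.ne_none_iff_exists'.1 (hne a ha)
      have hut : u a = t := by rw [hudef]; simp [hta]
      rw [hut]; exact (ho2 a t hta (p a)).1 (h a ha)
    · rintro ⟨⟨hw, hne⟩, h⟩
      refine ⟨hw, fun a ha => ?_⟩
      obtain ⟨t, hta⟩ := Option.ne_none_iff_exists'.1 (hne a ha)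
      have hut : u a = t := by rw [hudef]; simp [hta]
      exact (ho2 a t hta (p a)).2 (by rw [← hut]; exact h a ha)
  have e : pb ω' A = univ.filter fun p : Pd d => (∃ i ∈ T', u i ≤ p i) ∨ (w₁' = true ∧ ∀ a ∈ S₁, u a ≤ p a)
      ∨ (w₂' = true ∧ ∀ a ∈ S₂, u a ≤ p a) := by
    ext p; rw [mem_pb, Finset.mem_filter]
    simp only [Finset.mem_univ, true_and]
    have litA : (∃ i ∈ T, c i ≤ ω' (p i) i) ↔ (∃ i ∈ T', u i ≤ p i) := by
      constructor
      · rintro ⟨i, hi, hle⟩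
        have hne : o i ≠ none := fun hn => ho1 i hn (p i) hle
        obtain ⟨t, hti⟩ := Option.ne_none_iff_exists'.1 hne
        refine ⟨i, by rw [hT', Finset.mem_filter]; exact ⟨hi, hne⟩, ?_⟩
        have hut : u i = t := by rw [hudef]; simp [hti]
        rw [hut]; exact (ho2 i t hti (p i)).1 hle
      · rintro ⟨i, hi, hle⟩
        rw [hT', Finset.mem_filter] at hi
        obtain ⟨t, hti⟩ := Option.ne_none_iff_exists'.1 hi.2
        have hut : u i = t := by rw [hudef]; simp [hti]
        exact ⟨i, hi.1, (ho2 i t hti (p i)).2 (by rw [← hut]; exact hle)⟩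
    rw [litA, orth S₁ w₁ p, orth S₂ w₂ p]
  rw [e]
  exact sStarD_clauseTwoOrthant_nonneg T' S₁ S₂ hT1' hT2' h12 u hu w₁' w₂' hB' hC'

/-- **SAHI'S `C₃` / KAHN'S INEQUALITY WITH A CLAUSE-OR-TWO-MONOMIALS SLOT ON EVERY GRID, homogeneous form** (every `d, K`). [this work] -/
theorem latticeE3_gridProd_nonneg_clauseTwoOrthant (g : Fin d → Fin (K + 1) → ℝ) (hg : ∀ a v, 0 ≤ g a v)
    (T S₁ S₂ : Finset (Fin d)) (hT1 : Disjoint T S₁) (hT2 : Disjoint T S₂) (h12 : Disjoint S₁ S₂) (c : Fin d → Fin (K + 1)) (w₁ w₂ : Bool)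
    {B C : Finset (Xd d K)} (hB : IsUpperSet (B : Set (Xd d K))) (hC : IsUpperSet (C : Set (Xd d K))) :
    0 ≤ latticeE3 (fun ω : Xd d K => ∏ a, g a (ω a))
      (univ.filter fun x : Xd d K => (∃ i ∈ T, c i ≤ x i) ∨ (w₁ = true ∧ ∀ a ∈ S₁, c a ≤ x a) ∨ (w₂ = true ∧ ∀ a ∈ S₂, c a ≤ x a)) B C := by
  have hcard : (0 : ℝ) < Fintype.card (Fin d → Equiv.Perm (Fin 3)) := by exact_mod_cast Fintype.card_pos
  have h := latticeE3_symm g (univ.filter fun x : Xd d K => (∃ i ∈ T, c i ≤ x i) ∨ (w₁ = true ∧ ∀ a ∈ S₁, c a ≤ x a)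
    ∨ (w₂ = true ∧ ∀ a ∈ S₂, c a ≤ x a)) B C
  have hsum : 0 ≤ ∑ ω : Fin 3 → Xd d K, (∏ cc, ∏ a, g a (ω cc a)) *
      (Ssym (univ.filter fun x : Xd d K => (∃ i ∈ T, c i ≤ x i) ∨ (w₁ = true ∧ ∀ a ∈ S₁, c a ≤ x a)
        ∨ (w₂ = true ∧ ∀ a ∈ S₂, c a ≤ x a)) B C ω : ℝ) :=
    Finset.sum_nonneg fun ω _ => mul_nonneg (Finset.prod_nonneg fun cc _ => Finset.prod_nonneg fun a _ => hg a _)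
      (by exact_mod_cast Ssym_nonneg_clauseTwoOrthant T S₁ S₂ hT1 hT2 h12 c w₁ w₂ hB hC ω)
  rw [← h] at hsum
  exact (mul_nonneg_iff_of_pos_left hcard).1 hsum

/-- **KAHN'S `E₃ ≥ 0` FOR A CLAUSE ∨ MONOMIAL ∨ MONOMIAL** (probability form, every grid): for every product probability weight `⊗ g_i` on
`[K+1]^d`, pairwise disjoint variable sets `T, S₁, S₂`, thresholds `c`, flags `w₁, w₂`, and all increasing events `B, C`:
`0 ≤ E₃(1_A, 1_B, 1_C)` for `A = {x : (∃ i ∈ T, c i ≤ x i) ∨ (w₁ ∧ ∀ a ∈ S₁, c a ≤ x a) ∨ (w₂ ∧ ∀ a ∈ S₂, c a ≤ x a)}` — Kahn's Conjecture 5 /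
Sahi's `C₃` when one of the three increasing events is a read-once monotone DNF with at most two terms of width ≥ 2. [this work] -/
theorem sahiE_three_clauseTwoOrthant_nonneg (g : Fin d → Fin (K + 1) → ℝ) (hg0 : ∀ i v, 0 ≤ g i v) (hg1 : ∀ i, ∑ v, g i v = 1)
    (T S₁ S₂ : Finset (Fin d)) (hT1 : Disjoint T S₁) (hT2 : Disjoint T S₂) (h12 : Disjoint S₁ S₂) (c : Fin d → Fin (K + 1)) (w₁ w₂ : Bool)
    {B C : Finset (Xd d K)} (hB : IsUpperSet (B : Set (Xd d K))) (hC : IsUpperSet (C : Set (Xd d K))) :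
    0 ≤ sahiE (fun ω : Xd d K => ∏ i, g i (ω i)) 3
      ![setInd (univ.filter fun x : Xd d K => (∃ i ∈ T, c i ≤ x i) ∨ (w₁ = true ∧ ∀ a ∈ S₁, c a ≤ x a)
        ∨ (w₂ = true ∧ ∀ a ∈ S₂, c a ≤ x a)), setInd B, setInd C] := by
  classical
  have hsum : ∑ ω : Fin d → Fin (K + 1), ∏ i, g i (ω i) = 1 := by
    rw [← Fintype.prod_sum]; simp [hg1]
  rw [sahiE_three_indicator_eq_latticeE3 hsum]
  exact latticeE3_gridProd_nonneg_clauseTwoOrthant g hg0 T S₁ S₂ hT1 hT2 h12 c w₁ w₂ hB hC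

end Summit.CriticalPhenomena.PercolationContinuityZ3.Theorems.SahiGridPattern
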